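import Mathlib.NumberTheory.NumberField.Completion.FinitePlace
import Mathlib.NumberTheory.NumberField.Completion.InfinitePlace
import Mathlib.FieldTheory.Fixed
import Literature.NumberTheory.GaloisRepresentations.GaloisCohomology
import Literature.NumberTheory.GaloisRepresentations.GaloisRep
import HarnessLib

-- provenance: harness21/H21/H21/Prelude/GalRep/LocalGlobalCohomology.lean @ a90de71 (interim HEAD d8f2665); M5 mechanical rewrite
-- D-0014 sorry-free migration: cite tags (prover-migrate-pool-A-g21-0, 2026-08-13)
/-!
# Local–global Galois cohomology (GalRep trunk, item C14 = `G09:LocalGlobalCohomology`)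

Notion `galois_cohomology_discrete_module` (part 2, the interface consumed by BSD-type
statements): places of a number field, localisation maps `H¹(K, M) → H¹(K_v, M)`, the
Tate–Shafarevich group `Ш(K, M)`, Selmer structures and Selmer groups, the Tate dual
`M^∨(1) = Hom(M, μₙ)`, local Tate duality and "unramified almost everywhere".

## Main definitions

* `NumberField.Place K := InfinitePlace K ⊕ HeightOneSpectrum (𝓞 K)` (all places of a number
  field) and `NumberField.Place.Completion v` (`w.Completion`, resp. `v.adicCompletion K`) with
  its `Field` and `Algebra K` instances, by cases on the two Mathlib constructions.  Declared in
  Mathlib's `NumberField` namespace as a deliberate extension.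
* `Literature.DiscreteGaloisModule.toLocal ρ v` (restriction to `Γ_{K_v}` along
  `Literature.NumberTheory.GaloisRepresentations.absGaloisRestrict`), `Literature.galoisCohomology.localization ρ v n : Hⁿ(K, M) →+ Hⁿ(K_v, M)`
  (`= galoisCohomology.res`).
* `Literature.DiscreteGaloisModule.sha ρ = Ш(K, M) = ⋂ᵥ ker locᵥ ≤ H¹(K, M)`, `mem_sha_iff`,
  `shaAwayFrom ρ S` (no condition at `S`).
* `Literature.DiscreteGaloisModule.SelmerStructure ρ` (local conditions `𝓛_v ≤ H¹(K_v, M)`),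
  `SelmerStructure.selmerGroup 𝓛 = H¹_𝓛(K, M)`, `mem_selmerGroup_iff`, `le_selmerGroup_iff`,
  `sha_le_selmerGroup`, `sha_eq_selmerGroup_bot`, `le_sha_iff_forall_le_selmerGroup`.
* `Literature.DiscreteGaloisModule.TateDual K M n = Hom(M, μₙ(K̄))` (type synonym, discrete topology)
  and the discrete Galois module `DiscreteGaloisModule.tateDual ρ n = M^∨(1)` for finite `M`
  (action `(σf)(m) = σ f(σ⁻¹ m)`; continuity proved).
* `Literature.absInertiaField K 𝔓 = K̄^{I_𝔓}` and `Literature.galoisCohomology.IsUnramifiedAt v c`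
  (restriction of `c` to every inertia group above `v` vanishes).

## Main statements (named facts `def … : Prop`, D-0014)

* `Literature.NumberTheory.GaloisRepresentations.localization_eq_zero_cofinite`: every `c ∈ H¹(K, M)` is unramified at all but finitely
  many `v` (Milne, *ADT*, I §4).
* `Literature.NumberTheory.GaloisRepresentations.exists_perfectPairing_galoisCohomology_tateDual`: local Tate duality
  `H¹(K_v, M) × H¹(K_v, M^∨(1)) → ℤ/n` perfect, for finite `n`-torsion `M` at a finite place
  (Tate 1962; Milne, *ADT*, I Cor. 2.3).

## Mathlib declarations used rather than redefined

`NumberField.InfinitePlace.Completion`, `IsDedekindDomain.HeightOneSpectrum.adicCompletion`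
(with their `Field`/`Algebra K` instances), `AddMonoidHom.ker`, `AddSubgroup.comap`, `iInf` of
subgroups, `rootsOfUnity`, `Ideal.inertia`, `FixedPoints.intermediateField`, `Filter.cofinite`,
`AddMonoidHom.flip`.  Mathlib has no type of all places (`NumberField.FinitePlace` is the type of
finite places as absolute values), no Tate–Shafarevich or Selmer group of a Galois module
(`IsDedekindDomain.selmerGroup` is the subgroup `K⟮S, n⟯` of `Kˣ/(Kˣ)ⁿ`; see the docstring of
`SelmerStructure.selmerGroup`), no local Tate duality.

## Design notes

* Universe: as in `GaloisCohomology`, cohomology needs `M : Type u` (universe of `K`); both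
  completions live in `Type u`, so `localization` typechecks as `galoisCohomology.res`.
* `toLocal` here takes a `Place K`; on `Sum.inr v` it is definitionally `GaloisRep.toLocal v`,
  on `Sum.inl w` it is `GaloisRep.toInfinite w`.
* The outline's `sha_le_selmerGroup_iff` is split into the inclusion `sha_le_selmerGroup`
  (always true) and the genuine characterisation `le_sha_iff_forall_le_selmerGroup`, to avoid
  an `↔ True` statement.
* "Unramified almost everywhere" is phrased globally and choice-free through the inertia
  fields `K̄^{I_𝔓}`, `𝔓 ∣ v` (restriction to `Γ_{K̄^{I_𝔓}} = I_𝔓`), rather than through the local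
  inertia group of `K_v`, which would need the `IsNonarchimedeanLocalField` instance arguments
  of OUTLINE D2 inside an `∀ᶠ v` quantifier.  The literal reading "`loc_v c = 0` for cofinitely
  many `v`" of the outline name is false (e.g. quadratic characters), so the theorem
  `localization_eq_zero_cofinite` asserts unramifiedness, as the outline's gloss says.
* Local Tate duality is stated as the existence of a bi-additive pairing into `ZMod n` with
  both adjoints bijective (the cup product into `H²(K_v, μₙ) ≃ ℤ/n` is not constructed here).
* Instances added: only on the new type synonym `TateDual` (and the by-cases instances on the
  new `Place.Completion`); nothing on Mathlib types.

## References

* J. Tate, *Duality theorems in Galois cohomology over number fields*, Proc. ICM Stockholm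
  1962, 288–295.
* J. S. Milne, *Arithmetic Duality Theorems*, 2nd ed. (2006), Ch. I §§0, 2, 4, 6.
* J.-P. Serre, *Galois Cohomology* (1997), Ch. II §§5–6.
* B. Mazur, K. Rubin, *Kolyvagin systems*, Mem. AMS 799 (2004), §§1.1, 2.1.
* J. Neukirch, *Algebraic Number Theory* (1999), Ch. I §9, Ch. III §1.
-/

noncomputable section

open scoped NumberField
open Field IsDedekindDomain Topology

universe u w

/-! ### Places of a number field and their completions -/

namespace NumberField

/-- A **place** of the field `K` (intended for a number field): either an infinite place
`w : NumberField.InfinitePlace K` or a finite place, i.e. a nonzero prime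
`v : IsDedekindDomain.HeightOneSpectrum (𝓞 K)` of the ring of integers.  (Mathlib has the two
halves — and `NumberField.FinitePlace K` as absolute values — but no single type of all places;
grep `Place` in `Mathlib/NumberTheory/NumberField`.)  Declared in the `NumberField` namespace as
a deliberate extension.
Ref: J. Neukirch, *Algebraic Number Theory* (1999), Ch. III §1. [folklore] -/
abbrev Place (K : Type u) [Field K] : Type u :=
  InfinitePlace K ⊕ HeightOneSpectrum (𝓞 K)

namespace Place

variable {K : Type u} [Field K] [NumberField K]

/-- The **completion** `K_v` of `K` at a place `v`: `w.Completion` (Mathlib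
`NumberField.InfinitePlace.Completion`, i.e. `ℝ` or `ℂ` up to isomorphism) at an infinite
place, `v.adicCompletion K` (Mathlib `IsDedekindDomain.HeightOneSpectrum.adicCompletion`) at a
finite place.  Ref: J. Neukirch, *Algebraic Number Theory* (1999), Ch. II §4, Ch. III §1. [folklore] -/
def Completion : Place K → Type u
  | Sum.inl w => w.Completion
  | Sum.inr v => v.adicCompletion K

/-- `K_v` is a field (by cases: Mathlib's `InfinitePlace.Completion.instField` and the `Field`
instance on `adicCompletion`).  Ref: Neukirch, *Algebraic Number Theory*, Ch. II §4. [folklore] -/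
instance instFieldCompletion : (v : Place K) → Field (Completion v)
  | Sum.inl w => inferInstanceAs (Field w.Completion)
  | Sum.inr v => inferInstanceAs (Field (v.adicCompletion K))

/-- `K_v` is a `K`-algebra (by cases, both instances from Mathlib).
Ref: Neukirch, *Algebraic Number Theory*, Ch. II §4. [folklore] -/
instance instAlgebraCompletion : (v : Place K) → Algebra K (Completion v)
  | Sum.inl w => inferInstanceAs (Algebra K w.Completion)
  | Sum.inr v => inferInstanceAs (Algebra K (v.adicCompletion K))

end Place

end NumberField

namespace Literature.NumberTheory.GaloisRepresentations

open NumberField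

/-! ### Localisation of Galois cohomology classes -/

namespace DiscreteGaloisModule

variable {K : Type u} [Field K] [NumberField K] {M : Type w} [AddCommGroup M]
  [TopologicalSpace M] [DiscreteTopology M]

/-- The local Galois module `M|_{Γ_{K_v}}` at a place `v` of `K`: restriction of the discrete
`Γ_K`-module `ρ` along the fixed continuous map `absGaloisRestrict K K_v : Γ_{K_v} →ₜ* Γ_K`
(`GaloisRep.restrictField`; agrees definitionally with `GaloisRep.toLocal`/`GaloisRep.toInfinite`
on the two summands).  Ref: J.-P. Serre, *Galois Cohomology* (1997), Ch. II §6.1;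
J. S. Milne, *Arithmetic Duality Theorems* (2006), Ch. I §4. [folklore] -/
def toLocal (ρ : DiscreteGaloisModule K M) (v : Place K) :
    DiscreteGaloisModule (Place.Completion v) M :=
  GaloisRep.restrictField (Place.Completion v) ρ

/-- Unfolding lemma for `DiscreteGaloisModule.toLocal`. [folklore] -/
@[simp] lemma toLocal_apply (ρ : DiscreteGaloisModule K M) (v : Place K)
    (σ : absoluteGaloisGroup (Place.Completion v)) :
    ρ.toLocal v σ = ρ (absGaloisRestrict K (Place.Completion v) σ) := rfl

end DiscreteGaloisModule

section Localization

variable {K : Type u} [Field K] [NumberField K] {M : Type u} [AddCommGroup M]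
  [TopologicalSpace M] [DiscreteTopology M]

/-- The **localisation map** `Hⁿ(K, M) →+ Hⁿ(K_v, M)` at a place `v`: the restriction map
`galoisCohomology.res` to the completion `K_v = Place.Completion v`.
Ref: J. S. Milne, *Arithmetic Duality Theorems* (2006), Ch. I §4; Serre, *Galois Cohomology*
(1997), Ch. II §6.1. [folklore] -/
def galoisCohomology.localization (ρ : DiscreteGaloisModule K M) (v : Place K) (n : ℕ) :
    galoisCohomology ρ n →+ galoisCohomology (ρ.toLocal v) n :=
  galoisCohomology.res ρ (Place.Completion v) n

end Localization

/-! ### The Tate–Shafarevich group and Selmer groups of a discrete Galois module -/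

namespace DiscreteGaloisModule

variable {K : Type u} [Field K] [NumberField K] {M : Type u} [AddCommGroup M]
  [TopologicalSpace M] [DiscreteTopology M]

/-- The **Tate–Shafarevich group** `Ш(K, M) = Ш¹(K, M) ≤ H¹(K, M)` of a discrete Galois module
over a number field: the classes that are locally trivial at *every* place,
`Ш(K, M) = ⋂ᵥ ker (H¹(K, M) → H¹(K_v, M))`.  For `M = E(K̄)` this is `Ш(E/K)`.
Ref: J. S. Milne, *Arithmetic Duality Theorems* (2006), Ch. I §4 (notation `Ш¹_S`) and §6;
J. W. S. Cassels, *Arithmetic on curves of genus 1 (IV)*, J. reine angew. Math. 211 (1962). [folklore] -/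
def sha (ρ : DiscreteGaloisModule K M) : AddSubgroup (galoisCohomology ρ 1) :=
  ⨅ v : Place K, (galoisCohomology.localization ρ v 1).ker

/-- Membership in `Ш(K, M)`: all localisations vanish.
Ref: Milne, *Arithmetic Duality Theorems* (2006), Ch. I §4. [folklore] -/
@[simp] theorem mem_sha_iff (ρ : DiscreteGaloisModule K M) (c : galoisCohomology ρ 1) :
    c ∈ ρ.sha ↔ ∀ v : Place K, galoisCohomology.localization ρ v 1 c = 0 := by
  simp [sha, AddSubgroup.mem_iInf, AddMonoidHom.mem_ker]

/-- The group `Ш_S(K, M) ≤ H¹(K, M)` of classes locally trivial at every place *outside* `S`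
(no condition at the places of `S`); `shaAwayFrom ρ ∅ = sha ρ` (`shaAwayFrom_empty`).
Ref: Milne, *Arithmetic Duality Theorems* (2006), Ch. I §4 (the groups `Ш¹_S(K, M)`, with the
complementary convention on `S`); B. Mazur, K. Rubin, *Kolyvagin systems* (2004), §2.1. [folklore] -/
def shaAwayFrom (ρ : DiscreteGaloisModule K M) (S : Set (Place K)) :
    AddSubgroup (galoisCohomology ρ 1) :=
  ⨅ v ∈ Sᶜ, (galoisCohomology.localization ρ v 1).ker

/-- Membership in `Ш_S(K, M)`.  Ref: Milne, *Arithmetic Duality Theorems* (2006), Ch. I §4. [folklore] -/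
@[simp] theorem mem_shaAwayFrom_iff (ρ : DiscreteGaloisModule K M) (S : Set (Place K))
    (c : galoisCohomology ρ 1) :
    c ∈ ρ.shaAwayFrom S ↔ ∀ v ∉ S, galoisCohomology.localization ρ v 1 c = 0 := by
  simp [shaAwayFrom, AddSubgroup.mem_iInf, AddMonoidHom.mem_ker]

/-- `Ш_∅(K, M) = Ш(K, M)`.  Ref: Milne, *Arithmetic Duality Theorems* (2006), Ch. I §4. [folklore] -/
@[simp] theorem shaAwayFrom_empty (ρ : DiscreteGaloisModule K M) : ρ.shaAwayFrom ∅ = ρ.sha := by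
  ext c
  simp

/-- `Ш(K, M) ≤ Ш_S(K, M)` for every `S`.  Ref: Milne, *Arithmetic Duality Theorems*, Ch. I §4. [folklore] -/
theorem sha_le_shaAwayFrom (ρ : DiscreteGaloisModule K M) (S : Set (Place K)) :
    ρ.sha ≤ ρ.shaAwayFrom S := fun c hc => by
  rw [mem_sha_iff] at hc
  exact (mem_shaAwayFrom_iff ρ S c).2 fun v _ => hc v

/-- A **Selmer structure** (system of local conditions) on a discrete Galois module `ρ` over a
number field: a subgroup `𝓛_v ≤ H¹(K_v, M)` for every place `v`.  (No "unramified almost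
everywhere" requirement is imposed in the definition; cf. `localization_eq_zero_cofinite`.)
Ref: B. Mazur, K. Rubin, *Kolyvagin systems*, Mem. AMS 799 (2004), Definition 2.1.1;
Milne, *Arithmetic Duality Theorems* (2006), Ch. I §6 (Selmer groups of isogenies). [folklore] -/
abbrev SelmerStructure (ρ : DiscreteGaloisModule K M) : Type u :=
  ∀ v : Place K, AddSubgroup (galoisCohomology (ρ.toLocal v) 1)

namespace SelmerStructure

variable {ρ : DiscreteGaloisModule K M}

/-- The **Selmer group** `H¹_𝓛(K, M) = {c ∈ H¹(K, M) | locᵥ c ∈ 𝓛_v for all v}` of a Selmer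
structure `𝓛`.  Namespaced (`𝓛.selmerGroup`) to avoid a clash with Mathlib's
`IsDedekindDomain.selmerGroup` (`K⟮S, n⟯ ≤ Kˣ/(Kˣ)ⁿ`,
`Mathlib/RingTheory/DedekindDomain/SelmerGroup.lean`) under `open IsDedekindDomain`; in the
Kummer case `M = μₙ` the two are related through
`Literature.nonempty_addEquiv_galoisCohomology_mu_one : H¹(K, μₙ) ≃+ Kˣ/(Kˣ)ⁿ`, Mathlib's `K⟮S, n⟯`
being the Selmer group of the structure "unramified outside `S`, everything at `S`".
Ref: Mazur–Rubin, *Kolyvagin systems* (2004), Definition 2.1.1; Milne, *Arithmetic Duality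
Theorems* (2006), Ch. I §6. [folklore] -/
def selmerGroup (𝓛 : SelmerStructure ρ) : AddSubgroup (galoisCohomology ρ 1) :=
  ⨅ v : Place K, (𝓛 v).comap (galoisCohomology.localization ρ v 1)

/-- Membership in the Selmer group of `𝓛`.  Ref: Mazur–Rubin, *Kolyvagin systems*, Def. 2.1.1. [folklore] -/
@[simp] theorem mem_selmerGroup_iff (𝓛 : SelmerStructure ρ) (c : galoisCohomology ρ 1) :
    c ∈ 𝓛.selmerGroup ↔ ∀ v : Place K, galoisCohomology.localization ρ v 1 c ∈ 𝓛 v := by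
  simp [selmerGroup, AddSubgroup.mem_iInf]

/-- A subgroup `N ≤ H¹(K, M)` lies in the Selmer group of `𝓛` iff its localisation at every
place `v` lies in `𝓛_v` (the Selmer group is the largest subgroup with prescribed local images).
Ref: Mazur–Rubin, *Kolyvagin systems* (2004), Definition 2.1.1. [folklore] -/
theorem le_selmerGroup_iff (𝓛 : SelmerStructure ρ) (N : AddSubgroup (galoisCohomology ρ 1)) :
    N ≤ 𝓛.selmerGroup ↔ ∀ v : Place K, N.map (galoisCohomology.localization ρ v 1) ≤ 𝓛 v := by
  simp only [selmerGroup, le_iInf_iff, AddSubgroup.map_le_iff_le_comap]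

end SelmerStructure

/-- `Ш(K, M) ≤ H¹_𝓛(K, M)` for every Selmer structure `𝓛` (as `0 ∈ 𝓛_v`); equivalently
`Ш(K, M)` is the Selmer group of the zero Selmer structure (`sha_eq_selmerGroup_bot`), and
`Ш(K, M)` is the intersection of all Selmer groups (`le_sha_iff_forall_le_selmerGroup`, the
genuine `iff` behind the outline's `sha_le_selmerGroup_iff`).
Ref: Milne, *Arithmetic Duality Theorems* (2006), Ch. I §6, sequence (6.14)
(`Sel ↠ Ш[n]`); Mazur–Rubin, *Kolyvagin systems* (2004), §2.1. [folklore] -/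
theorem sha_le_selmerGroup (ρ : DiscreteGaloisModule K M) (𝓛 : SelmerStructure ρ) :
    ρ.sha ≤ 𝓛.selmerGroup := by
  intro c hc
  rw [mem_sha_iff] at hc
  exact (𝓛.mem_selmerGroup_iff c).2 fun v => by simpa only [hc v] using zero_mem (𝓛 v)

/-- `Ш(K, M)` is the Selmer group of the zero Selmer structure `𝓛_v = 0` for all `v`.
Ref: Mazur–Rubin, *Kolyvagin systems* (2004), §2.1. [folklore] -/
theorem sha_eq_selmerGroup_bot (ρ : DiscreteGaloisModule K M) :
    ρ.sha = (⊥ : SelmerStructure ρ).selmerGroup := by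
  ext c
  simp

/-- `Ш(K, M)` is the intersection of all Selmer groups: a subgroup `N ≤ H¹(K, M)` is contained
in `Ш(K, M)` iff it is contained in `H¹_𝓛(K, M)` for every Selmer structure `𝓛`.
Ref: Mazur–Rubin, *Kolyvagin systems* (2004), §2.1; Milne, *ADT* (2006), Ch. I §6. [folklore] -/
theorem le_sha_iff_forall_le_selmerGroup (ρ : DiscreteGaloisModule K M)
    (N : AddSubgroup (galoisCohomology ρ 1)) :
    N ≤ ρ.sha ↔ ∀ 𝓛 : SelmerStructure ρ, N ≤ 𝓛.selmerGroup :=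
  ⟨fun h 𝓛 => h.trans (ρ.sha_le_selmerGroup 𝓛), fun h => ρ.sha_eq_selmerGroup_bot ▸ h ⊥⟩

end DiscreteGaloisModule

/-! ### The Tate dual `M^∨(1) = Hom(M, μₙ)` -/

namespace DiscreteGaloisModule

/-- The carrier `Hom(M, μₙ(K̄))` of the Tate dual of an `n`-torsion module `M`: additive
homomorphisms `M →+ μₙ(K̄)` (roots of unity written additively).  A type synonym, so that the
discrete topology can be registered without touching Mathlib's `AddMonoidHom`.
Ref: J. S. Milne, *Arithmetic Duality Theorems* (2006), Ch. I §2 (the dual `M^D = Hom(M, μ)`);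
Serre, *Galois Cohomology* (1997), Ch. II §5.1. [folklore] -/
def TateDual (K : Type u) [Field K] (M : Type w) [AddCommGroup M] (n : ℕ) : Type (max u w) :=
  M →+ Additive (rootsOfUnity n (AlgebraicClosure K))

namespace TateDual

variable {K : Type u} [Field K] {M : Type w} [AddCommGroup M] {n : ℕ}

/-- `Hom(M, μₙ)` is an abelian group (pointwise).  Ref: Milne, *ADT*, Ch. I §2. [folklore] -/
instance instAddCommGroup : AddCommGroup (TateDual K M n) :=
  inferInstanceAs (AddCommGroup (M →+ Additive (rootsOfUnity n (AlgebraicClosure K))))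

/-- Elements of `Hom(M, μₙ)` are functions.  Ref: Milne, *ADT*, Ch. I §2. [folklore] -/
instance instFunLike :
    FunLike (TateDual K M n) M (Additive (rootsOfUnity n (AlgebraicClosure K))) :=
  inferInstanceAs (FunLike (M →+ Additive (rootsOfUnity n (AlgebraicClosure K))) M _)

/-- Elements of `Hom(M, μₙ)` are additive homomorphisms.  Ref: Milne, *ADT*, Ch. I §2. [folklore] -/
instance instAddMonoidHomClass :
    AddMonoidHomClass (TateDual K M n) M (Additive (rootsOfUnity n (AlgebraicClosure K))) :=
  inferInstanceAs
    (AddMonoidHomClass (M →+ Additive (rootsOfUnity n (AlgebraicClosure K))) M _)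

/-- The **discrete topology** on `Hom(M, μₙ)`.  Ref: Milne, *ADT*, Ch. I §2. [folklore] -/
instance instTopologicalSpace : TopologicalSpace (TateDual K M n) := ⊥

/-- The topology on `Hom(M, μₙ)` is discrete by definition. [folklore] -/
instance instDiscreteTopology : DiscreteTopology (TateDual K M n) := ⟨rfl⟩

/-- Extensionality for `Hom(M, μₙ)`. [folklore] -/
@[ext] lemma ext {f g : TateDual K M n} (h : ∀ m, f m = g m) : f = g := DFunLike.ext f g h

/-- Pointwise addition in `Hom(M, μₙ)`. [folklore] -/
@[simp] lemma add_apply (f g : TateDual K M n) (m : M) : (f + g) m = f m + g m := rfl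

/-- The zero of `Hom(M, μₙ)`. [folklore] -/
@[simp] lemma zero_apply (m : M) : (0 : TateDual K M n) m = 0 := rfl

end TateDual

variable {K : Type u} [Field K] {M : Type w} [AddCommGroup M] [TopologicalSpace M]
  [DiscreteTopology M]

/-- The action of `σ ∈ Γ_K` on `Hom(M, μₙ)`: `(σ • f)(m) = σ • f(ρ(σ⁻¹) m)` (as an additive
endomorphism).  Ref: Milne, *Arithmetic Duality Theorems* (2006), Ch. I §0 ("`G` acts on
`Hom(M, N)` by `(σf)(m) = σ(f(σ⁻¹m))`"). [folklore] -/
def tateDualEnd (ρ : DiscreteGaloisModule K M) (n : ℕ) (σ : absoluteGaloisGroup K) :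
    TateDual K M n →+ TateDual K M n where
  toFun f := (((mu K n σ).toAddMonoidHom.comp
    ((f : M →+ Additive (rootsOfUnity n (AlgebraicClosure K))).comp (ρ σ⁻¹).toAddMonoidHom)) :
      M →+ Additive (rootsOfUnity n (AlgebraicClosure K)))
  map_zero' := AddMonoidHom.ext fun _ => map_zero (mu K n σ)
  map_add' _ _ := AddMonoidHom.ext fun _ => map_add (mu K n σ) _ _

/-- Unfolding lemma for `tateDualEnd`. [folklore] -/
@[simp] lemma tateDualEnd_apply_apply (ρ : DiscreteGaloisModule K M) (n : ℕ)
    (σ : absoluteGaloisGroup K) (f : TateDual K M n) (m : M) :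
    tateDualEnd ρ n σ f m = mu K n σ (f (ρ σ⁻¹ m)) := rfl

/-- The underlying `ℤ`-linear representation of the Tate dual, `σ ↦ (f ↦ σ ∘ f ∘ ρ(σ⁻¹))`.
Ref: Milne, *Arithmetic Duality Theorems* (2006), Ch. I §0, §2. [folklore] -/
def tateDualRepresentation (ρ : DiscreteGaloisModule K M) (n : ℕ) :
    Representation ℤ (absoluteGaloisGroup K) (TateDual K M n) where
  toFun σ := (tateDualEnd ρ n σ).toIntLinearMap
  map_one' := by
    refine LinearMap.ext fun f => TateDual.ext fun m => ?_
    simp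
  map_mul' σ τ := by
    refine LinearMap.ext fun f => TateDual.ext fun m => ?_
    simp only [AddMonoidHom.coe_toIntLinearMap, Module.End.mul_apply, tateDualEnd_apply_apply,
      mul_inv_rev, map_mul]

/-- Unfolding lemma for `tateDualRepresentation`. [folklore] -/
@[simp] lemma tateDualRepresentation_apply_apply_apply (ρ : DiscreteGaloisModule K M) (n : ℕ)
    (σ : absoluteGaloisGroup K) (f : TateDual K M n) (m : M) :
    ρ.tateDualRepresentation n σ f m = mu K n σ (f (ρ σ⁻¹ m)) := rfl

/-- The **Tate dual** `M^∨(1) = M^D = Hom(M, μₙ(K̄))` of a *finite* discrete Galois module `M`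
(intended for `n`-torsion `M`, when `Hom(M, μₙ) = Hom(M, K̄ˣ)`), with `Γ_K` acting by
`(σ f)(m) = σ(f(σ⁻¹ m))`.  It is again a discrete Galois module: the stabiliser of `f` contains
the finite intersection `⋂ₘ (Stab_ρ(m) ∩ Stab_μ(f m))` of open stabilisers (real proof, using
`[Finite M]`).  `[NeZero (n : K)]` is not needed for the definition and therefore not assumed.
Ref: J. S. Milne, *Arithmetic Duality Theorems* (2006), Ch. I §2, Cor. 2.3 (local Tate
duality for `M^D = Hom(M, μ)`); Serre, *Galois Cohomology* (1997), Ch. II §5.1–5.2. [folklore] -/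
def tateDual (ρ : DiscreteGaloisModule K M) (n : ℕ) [Finite M] :
    DiscreteGaloisModule K (TateDual K M n) :=
  ContinuousRep.ofStabilizerMemNhdsOne (ρ.tateDualRepresentation n) fun f => by
    have h : ∀ m : M, ∀ᶠ σ in 𝓝 (1 : absoluteGaloisGroup K),
        ρ σ m = m ∧ mu K n σ (f m) = f m := fun m =>
      Filter.Eventually.and (ρ.setOf_apply_eq_mem_nhds_one m)
        ((mu K n).setOf_apply_eq_mem_nhds_one (f m))
    filter_upwards [Filter.eventually_all.2 h] with σ hσ
    refine TateDual.ext fun m => ?_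
    have h1 : ρ σ⁻¹ m = m := by
      conv_lhs => rw [← (hσ m).1]
      rw [← Module.End.mul_apply, ← map_mul, inv_mul_cancel, map_one, Module.End.one_apply]
    rw [tateDualRepresentation_apply_apply_apply, h1, (hσ m).2]

/-- Unfolding lemma for the Tate dual. [folklore] -/
@[simp] lemma tateDual_apply_apply_apply (ρ : DiscreteGaloisModule K M) (n : ℕ) [Finite M]
    (σ : absoluteGaloisGroup K) (f : TateDual K M n) (m : M) :
    ρ.tateDual n σ f m = mu K n σ (f (ρ σ⁻¹ m)) := rfl

end DiscreteGaloisModule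

/-! ### Unramified classes -/

section Unramified

variable {K : Type u} [Field K]

variable (K) in
/-- The **inertia field** `T_𝔓 = K̄^{I_𝔓} ⊆ K̄` of a prime `𝔓` of `\bar ℤ_K = absIntegers (𝓞 K) K`:
the subfield of `K̄` fixed by the inertia group `I_𝔓 = 𝔓.inertia Γ_K` (Mathlib `Ideal.inertia`,
`FixedPoints.intermediateField`).  Its absolute Galois group is `I_𝔓` (a closed subgroup,
`absIntegers.isClosed_inertia`), so restriction of cohomology to `T_𝔓` is restriction to inertia.
Ref: J. Neukirch, *Algebraic Number Theory* (1999), Ch. I §9 (9.5); Serre, *Local Fields*,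
Ch. I §7. [folklore] -/
def absInertiaField (𝔓 : Ideal (absIntegers (𝓞 K) K)) :
    IntermediateField K (AlgebraicClosure K) :=
  FixedPoints.intermediateField (F := K) (𝔓.inertia (absoluteGaloisGroup K))

/-- Membership in the inertia field: `x` is fixed by `I_𝔓`.
Ref: Neukirch, *Algebraic Number Theory* (1999), Ch. I §9. [folklore] -/
theorem mem_absInertiaField_iff (𝔓 : Ideal (absIntegers (𝓞 K) K)) (x : AlgebraicClosure K) :
    x ∈ absInertiaField K 𝔓 ↔ ∀ σ ∈ 𝔓.inertia (absoluteGaloisGroup K), σ • x = x := by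
  simp only [absInertiaField, FixedPoints.mem_intermediateField_iff, Subtype.forall,
    Subgroup.mk_smul]

variable {M : Type u} [AddCommGroup M] [TopologicalSpace M] [DiscreteTopology M]

/-- A cohomology class `c ∈ Hⁿ(K, M)` is **unramified at the finite place `v`** if its
restriction to the inertia group `I_𝔓 = Γ_{T_𝔓}` vanishes for every prime `𝔓 ∣ v` of `\bar ℤ_K`
(equivalently for one, the `I_𝔓` being conjugate; restriction `galoisCohomology.res` to the
inertia field `absInertiaField K 𝔓`).  For `n = 1` this says `loc_v c` lies in the unramified
subgroup `H¹_ur(K_v, M) = ker (H¹(K_v, M) → H¹(I_v, M))`.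
Ref: J. S. Milne, *Arithmetic Duality Theorems* (2006), Ch. I §4 (before Lemma 4.8);
Mazur–Rubin, *Kolyvagin systems* (2004), Definition 1.1.6 (`H¹_ur`). [folklore] -/
def galoisCohomology.IsUnramifiedAt {ρ : DiscreteGaloisModule K M} {n : ℕ}
    (v : HeightOneSpectrum (𝓞 K)) (c : galoisCohomology ρ n) : Prop :=
  ∀ 𝔓 ∈ v.primesAbove, galoisCohomology.res ρ (absInertiaField K 𝔓) n c = 0

/-- Unfolding lemma for `galoisCohomology.IsUnramifiedAt`. [folklore] -/
lemma galoisCohomology.isUnramifiedAt_iff {ρ : DiscreteGaloisModule K M} {n : ℕ}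
    (v : HeightOneSpectrum (𝓞 K)) (c : galoisCohomology ρ n) :
    c.IsUnramifiedAt v ↔
      ∀ 𝔓 ∈ v.primesAbove, galoisCohomology.res ρ (absInertiaField K 𝔓) n c = 0 :=
  Iff.rfl

end Unramified

/-! ### The main theorems (named facts, D-0014) -/

section Theorems

variable {K : Type u} [Field K] [NumberField K] {M : Type u} [AddCommGroup M]
  [TopologicalSpace M] [DiscreteTopology M]

/-- **Cohomology classes are unramified almost everywhere.**  For a discrete Galois module `M`
over a number field and `c ∈ H¹(K, M)`, the localisation of `c` restricted to inertia vanishes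
(`galoisCohomology.IsUnramifiedAt`) at all but finitely many finite places `v`.  (A continuous
cocycle on the profinite `Γ_K` with values in the discrete `M` vanishes on an open normal
subgroup `Gal(K̄/L)`, `L/K` finite, and `I_𝔓 ≤ Gal(K̄/L)` for `v` unramified in `L`.)  The name
records the outline's `localization_eq_zero_cofinite`; note that `loc_v c = 0` itself only holds
for a density-positive set of `v`, not cofinitely.
Ref: J. S. Milne, *Arithmetic Duality Theorems* (2006), Ch. I §4, proof of Lemma 4.8;
Serre, *Galois Cohomology* (1997), Ch. II §6.1.  The hypothesis `[NumberField K]` is bound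
explicitly (nothing else in the statement uses it, and the statement is false for, e.g.,
`K = ℚ(t)`, where geometric classes are ramified at every prime of `𝓞 K = ℤ`). [cite: MilneADT2006, Ch. I §4, Lemma 4.8] -/
def localization_eq_zero_cofinite : Prop :=
  ∀ [NumberField K] (ρ : DiscreteGaloisModule K M) (c : galoisCohomology ρ 1),
    ∀ᶠ v : HeightOneSpectrum (𝓞 K) in Filter.cofinite, c.IsUnramifiedAt v

/-- **Local Tate duality** at a finite place `v` of a number field, for a finite `n`-torsion
discrete Galois module `M` (`n ≠ 0`; `K_v` has characteristic `0`, so `n` is invertible):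
cup product and `inv_v : H²(K_v, μₙ) ≃ ℤ/n` give a perfect pairing
`H¹(K_v, M) × H¹(K_v, M^∨(1)) → ℤ/n`, i.e. a bi-additive map both of whose adjoints
`H¹(K_v, M) → Hom(H¹(K_v, M^∨(1)), ℤ/n)` and `H¹(K_v, M^∨(1)) → Hom(H¹(K_v, M), ℤ/n)` are
bijective (both groups being finite `n`-torsion, `Hom(–, ℤ/n)` is the Pontryagin dual).  Here
`M^∨(1) = ρ.tateDual n` restricted to `Γ_{K_v}` along `absGaloisRestrict` (isomorphic to
`Hom(M, μₙ(K̄_v))` via the chosen `K̄ ↪ K̄_v`).  Stated as existence of the pairing.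
Ref: J. Tate, *Duality theorems in Galois cohomology over number fields*, Proc. ICM 1962,
Thm. 2.1; J. S. Milne, *Arithmetic Duality Theorems* (2006), Ch. I, Cor. 2.3;
Serre, *Galois Cohomology* (1997), Ch. II §5.2, Thm. 2. [cite: MilneADT2006, Ch. I, Cor. 2.3] -/
def exists_perfectPairing_galoisCohomology_tateDual : Prop :=
  ∀ [Finite M] (ρ : DiscreteGaloisModule K M) (n : ℕ) [NeZero n], (∀ m : M, n • m = 0) →
    ∀ v : HeightOneSpectrum (𝓞 K),
    ∃ b : galoisCohomology (ρ.toLocal (Sum.inr v)) 1 →+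
        galoisCohomology ((ρ.tateDual n).toLocal (Sum.inr v)) 1 →+ ZMod n,
      Function.Bijective b ∧ Function.Bijective b.flip

end Theorems

end Literature.NumberTheory.GaloisRepresentations
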